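import Literature.Topology.FourManifolds.ManolescuPiccirillo2023CensusHolds
import Literature.Topology.FourManifolds.SliceRibbon
import HarnessLib

/-!
# kirby-cert/1 ribbon certificates: data schema and the decision logic they feed (venture SP4Inv)

Honest framing (cell `pub-sp4inv`, seat p3, HOME `run/shared/lean/pub/pub-sp4inv/`): this file types
the LOGIC by which a machine-replayed *band certificate* for a knot decides a row of the
Manolescu–Piccirillo zero-surgery census (sibling cell `pub-sp4mp`, bundle
`papers/SmoothPoincare4/sp4-mp-census`).  The certificate itself — a `kirby-cert/1` JSON file
(spec `HOME/p3/CERT-FORMAT-kirby.md`): a PD code, one orientation-coherent band move per saddle and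
Reidemeister-level isotopies (`R1±`, `PASS`, `FLOAT`, `REVERSE`) ending at a crossingless unlink,
every intermediate diagram recorded — is replayed OUTSIDE Lean by two programs; here it enters as
the named hypothesis `K.IsRibbon` (`ReplaySound` states the exact shape of that trust assumption:
a sound replayer plus "this PD code presents the knot `K`").  Nothing in this file asserts that any
particular diagram has any particular property, and nothing here is a claim about `S⁴`.

What is PROVED (no named hypothesis beyond those visible in each signature):
* `exotic_of_ribbon_partner`: for a census pair `(K_B, K_G)` with a common `0`-surgery, an integer
  knot invariant `s` obeying Rasmussen's slice obstruction with `s(K_G) ≠ 0`, and `K_B` ribbon, an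
  exotic `S⁴` exists — `MPCensus.exotic_of_flagged_pair_holds` (MP 2023 Thm 1.3, case `n = 0`,
  with MP Lemma 3.3 and the FGMW lemma PROVED in the tree) composed with
  `Knot.IsRibbon.isSmoothlySlice`.  This is the shape of the cell's row of interest
  `L14a28873[R=1,r=1]` (`K_G`: `s = 2` by two programs; `K_B`: 83 crossings, sliceness unknown).
* `unflagged_of_both_ribbon`: if both knots of a pair are ribbon, every slice-obstruction
  invariant vanishes on both, so the MP mechanism cannot fire in either direction (the census code
  `X-SLICE-BOTH`).
* `RibbonCert`, `RibbonCert.terminalOK`: the data schema of a `kirby-cert/1` ribbon certificate and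
  its decidable terminal condition, with the stevedore knot `6_1` as a kernel-evaluated example
  (`cert_6_1_terminalOK`; the four-move certificate is the cell's file `HOME/p3/certs/cert_ribbon_6_1.json`).

References: C. Manolescu, L. Piccirillo, J. Lond. Math. Soc. (2) 108 (2023) 2001–2036, Thm 1.3 and
Lemma 3.3; J. Rasmussen, Invent. Math. 182 (2010), Thm 1; N. Dunfield, S. Gong, arXiv:2512.21825 §2
(band searches for ribbon discs); R. E. Gompf, A. I. Stipsicz, *4-Manifolds and Kirby Calculus*
(1999) §6.2 (ribbon discs from band moves).
-/

open scoped Manifold ContDiff Topology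
open ContinuousMap

noncomputable section

namespace Summit.Ventures.SP4Inv

open Literature.Topology.FourManifolds Literature.Topology.FourManifolds.MPCensus

/-! ## 1. Data schema of a kirby-cert/1 ribbon certificate -/

/-- Kind of a diagram component: a framed 2-handle attaching circle or a dotted circle (1-handle).
In ribbon certificates every component is `framed` with framing `0` (bookkeeping only). [folklore] -/
inductive CompKind
  | framed
  | dotted
  deriving DecidableEq, Repr

/-- One crossing-bearing component of a `kirby-diagram/1` state: kind, framing (`none` for dotted
circles) and its edge labels in traversal order (this fixes the orientation). [folklore] -/
structure CompRec where
  kind : CompKind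
  framing : Option ℤ
  edges : List ℕ
  deriving DecidableEq, Repr

/-- A `kirby-diagram/1` state: PD code in the KnotInfo convention (under-strand edge coming in
first, then counterclockwise), the crossing signs (`+1` iff the over strand comes in at the fourth
entry; they make the orientation of 2-edge components unambiguous), crossing-bearing components,
crossingless (`loose`) components, and the number `h3` of 3-handles. [folklore] -/
structure PDState where
  pd : List (ℕ × ℕ × ℕ × ℕ)
  signs : List ℤ
  components : List CompRec
  loose : List (CompKind × Option ℤ)
  h3 : ℕ
  deriving DecidableEq, Repr

/-- Side of an edge (left/right of its orientation). [folklore] -/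
inductive Side
  | L
  | R
  deriving DecidableEq, Repr

/-- Which strand an arc is at each of its crossings. [folklore] -/
inductive Mode
  | over
  | under
  deriving DecidableEq, Repr

/-- The moves allowed in a RIBBON certificate (`CERT-FORMAT-kirby.md` §3): Reidemeister I removal /
insertion, `PASS` (re-route an arc lying entirely over or entirely under the rest; subsumes R2, R3),
`FLOAT` (a component lying entirely over/under the rest becomes a crossingless circle), `REVERSE`
(orientation reversal of one component), and the orientation-coherent `BAND` move with `t`
half-twists (a saddle). Edge arguments are labels of the previous state (`pass` also names the
re-routed arc in the NEXT state's labels, so that a checker compares the two cut-open diagrams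
without knowing how fresh labels are generated; its `route` is informative), crossing and
component arguments are 0-based indices. [folklore] -/
inductive RMove
  | r1minus (x : ℕ)
  | r1plus (e : ℕ) (side : Side) (sign : ℤ)
  | pass (mode : Mode) (eStart eEnd : ℕ) (route : List (ℕ × ℤ)) (eStartNew eEndNew : ℕ)
  | float (c : ℕ) (mode : Mode)
  | reverse (c : ℕ)
  | band (a b : ℕ) (da db : ℤ) (t : ℤ)
  deriving DecidableEq, Repr

/-- `true` iff the move is a band move (a saddle of the eventual ribbon disc). [folklore] -/
def RMove.isBand : RMove → Bool
  | .band _ _ _ _ _ => true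
  | _ => false

/-- A `kirby-cert/1` certificate of purpose `ribbon`: a start state (one knot) and the list of
(move, resulting state) pairs. [folklore] -/
structure RibbonCert where
  start : PDState
  steps : List (RMove × PDState)
  deriving Repr

namespace RibbonCert

variable (c : RibbonCert)

/-- Number of band moves (= saddles). [folklore] -/
def nBands : ℕ := (c.steps.filter fun s => s.1.isBand).length

/-- The final state (the start state if there are no steps). [folklore] -/
def final : PDState := (c.steps.getLast?.map Prod.snd).getD c.start

/-- The decidable TERMINAL condition of `CERT-FORMAT-kirby.md` §4 (`ribbon`): the start state is a
single knot, and the final state is crossingless with exactly `nBands + 1` components.  (The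
step-by-step replay — each move legal on the previous state and producing the recorded next state
up to planar-map isomorphism — is the external checkers' job; see `ReplaySound`.) [folklore] -/
def terminalOK : Bool :=
  (c.start.components.length == 1) && c.start.loose.isEmpty && (c.start.h3 == 0) &&
    c.final.pd.isEmpty && c.final.components.isEmpty && (c.final.loose.length == c.nBands + 1)

end RibbonCert

/-! ## 2. The trust assumption, stated exactly -/

/-- **Shape of the replay-soundness assumption.** `Presents S K` is an (external) assertion that
the PD state `S` is a diagram of the knot `K`; `Accepts c` that an independent replayer accepted
every step of `c` (each move legal, each recorded state reached).  Soundness of the pair says: an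
accepted certificate whose terminal condition holds makes the presented knot RIBBON — because
`R1±/PASS/FLOAT/REVERSE` are ambient isotopies and each `BAND` is a saddle, so the knot bounds an
immersed-free disc with `nBands` saddles and `nBands + 1` minima (Gompf–Stipsicz §6.2).  This is a
definition (the hypothesis consumers must name), not an assertion. [folklore] -/
def ReplaySound (Presents : PDState → Knot → Prop) (Accepts : RibbonCert → Prop) : Prop :=
  ∀ c : RibbonCert, Accepts c → c.terminalOK = true → ∀ K : Knot, Presents c.start K → K.IsRibbon

/-- Reading a certificate through the trust assumption: an accepted, terminal certificate whose
start state presents `K` gives `K.IsRibbon`. [folklore] -/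
theorem isRibbon_of_cert {Presents : PDState → Knot → Prop} {Accepts : RibbonCert → Prop}
    (hS : ReplaySound Presents Accepts) {c : RibbonCert} (hA : Accepts c)
    (hT : c.terminalOK = true) {K : Knot} (hP : Presents c.start K) : K.IsRibbon :=
  hS c hA hT K hP

/-! ## 3. Decision logic for a census pair -/

/-- **Exotic sphere from a certified ribbon partner** (the `disproof` direction of the census row
of interest): if `K_B` and `K_G` have a common `0`-surgery, `s` is an integer knot invariant with
Rasmussen's slice obstruction (`SliceObstruction s`: smoothly slice ⇒ `s = 0`), `s(K_G) ≠ 0`, and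
`K_B` is ribbon, then there is a closed smooth `4`-manifold homotopy equivalent but not diffeomorphic
to the round `S⁴` (an exotic `S⁴`, via Freedman).  Proof: `K_B` ribbon ⇒ smoothly slice
(`Knot.IsRibbon.isSmoothlySlice`), then MP Thm 1.3 (`n = 0`) in its discharged tree form
`MPCensus.exotic_of_flagged_pair_holds`. [cite: ManolescuPiccirillo2023, Thm 1.3 (proof), §1 p. 1] -/
theorem exotic_of_ribbon_partner
    {s : Knot → ℤ} (hRas : SliceObstruction s)
    {K_B K_G : Knot} (h0 : CommonZeroSurgery K_B K_G) (hs : s K_G ≠ 0) (hrib : K_B.IsRibbon) :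
    ∃ (M : Type) (_ : TopologicalSpace M) (_ : T2Space M) (_ : SecondCountableTopology M)
      (_ : ChartedSpace (EuclideanSpace ℝ (Fin 4)) M) (_ : IsManifold (𝓡 4) ∞ M) (_ : CompactSpace M),
      Nonempty (M ≃ₕ (Metric.sphere (0 : EuclideanSpace ℝ (Fin 5)) 1)) ∧
        IsEmpty (M ≃ₘ⟮𝓡 4, 𝓡 4⟯ (Metric.sphere (0 : EuclideanSpace ℝ (Fin 5)) 1)) :=
  exotic_of_flagged_pair_holds hRas h0 hs hrib.isSmoothlySlice

/-- The same with the certificate hypothesis spelled out: a sound replayer, an accepted terminal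
certificate presenting `K_B`, a common `0`-surgery and `s(K_G) ≠ 0` give an exotic `S⁴`.
[cite: ManolescuPiccirillo2023, Thm 1.3 (proof), §1 p. 1] -/
theorem exotic_of_ribbon_cert
    {Presents : PDState → Knot → Prop} {Accepts : RibbonCert → Prop}
    (hS : ReplaySound Presents Accepts) {c : RibbonCert} (hA : Accepts c) (hT : c.terminalOK = true)
    {s : Knot → ℤ} (hRas : SliceObstruction s)
    {K_B K_G : Knot} (hP : Presents c.start K_B) (h0 : CommonZeroSurgery K_B K_G) (hs : s K_G ≠ 0) :
    ∃ (M : Type) (_ : TopologicalSpace M) (_ : T2Space M) (_ : SecondCountableTopology M)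
      (_ : ChartedSpace (EuclideanSpace ℝ (Fin 4)) M) (_ : IsManifold (𝓡 4) ∞ M) (_ : CompactSpace M),
      Nonempty (M ≃ₕ (Metric.sphere (0 : EuclideanSpace ℝ (Fin 5)) 1)) ∧
        IsEmpty (M ≃ₘ⟮𝓡 4, 𝓡 4⟯ (Metric.sphere (0 : EuclideanSpace ℝ (Fin 5)) 1)) :=
  exotic_of_ribbon_partner hRas h0 hs (isRibbon_of_cert hS hA hT hP)

/-- **Both ribbon ⇒ unflaggable** (census code `X-SLICE-BOTH`): if both knots of a pair are ribbon
then every invariant with Rasmussen's slice obstruction vanishes on both, so neither ordering of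
the pair can satisfy the hypothesis `s ≠ 0` of `exotic_of_ribbon_partner`. [folklore] -/
theorem unflagged_of_both_ribbon {s : Knot → ℤ} (hRas : SliceObstruction s)
    {K_B K_G : Knot} (hB : K_B.IsRibbon) (hG : K_G.IsRibbon) : s K_B = 0 ∧ s K_G = 0 :=
  ⟨hRas K_B hB.isSmoothlySlice, hRas K_G hG.isSmoothlySlice⟩

/-- Contrapositive bookkeeping for the row of interest: under the same hypotheses, if NO exotic
`S⁴` exists (the smooth `4`-dimensional Poincaré conjecture for this construction), then `K_B` is
not ribbon — so an honest negative ribbon search is what SPC4 predicts. [folklore] -/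
theorem not_isRibbon_of_no_exotic
    {s : Knot → ℤ} (hRas : SliceObstruction s)
    {K_B K_G : Knot} (h0 : CommonZeroSurgery K_B K_G) (hs : s K_G ≠ 0)
    (hno : ¬ ∃ (M : Type) (_ : TopologicalSpace M) (_ : T2Space M) (_ : SecondCountableTopology M)
      (_ : ChartedSpace (EuclideanSpace ℝ (Fin 4)) M) (_ : IsManifold (𝓡 4) ∞ M) (_ : CompactSpace M),
      Nonempty (M ≃ₕ (Metric.sphere (0 : EuclideanSpace ℝ (Fin 5)) 1)) ∧
        IsEmpty (M ≃ₘ⟮𝓡 4, 𝓡 4⟯ (Metric.sphere (0 : EuclideanSpace ℝ (Fin 5)) 1))) :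
    ¬ K_B.IsRibbon :=
  fun hrib => hno (exotic_of_ribbon_partner hRas h0 hs hrib)

/-! ## 4. A kernel-evaluated example of the data path -/

/-- The replay-verified kirby-cert/1 ribbon certificate of the stevedore knot `6_1` (KnotInfo PD; one band,
then Reidemeister-level isotopies to the crossingless 2-component unlink), transcribed from
`HOME/p3/certs/cert_ribbon_6_1.json` of the cell. Data only. [folklore] -/
def cert_6_1 : RibbonCert where
  start := ⟨[(1, 7, 2, 6), (3, 10, 4, 11), (5, 3, 6, 2), (7, 1, 8, 12), (9, 4, 10, 5), (11, 9, 12, 8)], [1, -1, 1, 1, -1, 1], [⟨.framed, (some (0)), [1, 2, 3, 4, 5, 6, 7, 8, 9, 10, 11, 12]⟩], [], 0⟩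
  steps := [(.band 8 3 (1) (-1) (-1), ⟨[(1, 7, 2, 6), (13, 10, 4, 11), (5, 3, 6, 2), (7, 1, 8, 12), (9, 4, 10, 5), (11, 9, 12, 14), (8, 3, 13, 14)], [1, -1, 1, 1, -1, 1, -1], [⟨.framed, (some (0)), [4, 5, 6, 7, 8, 13]⟩, ⟨.framed, (some (0)), [1, 2, 3, 14, 9, 10, 11, 12]⟩], [], 0⟩),
    (.pass .over 2 9 [] 2 2, ⟨[(1, 7, 2, 5), (8, 10, 4, 11), (7, 1, 8, 11), (2, 4, 10, 5)], [1, -1, 1, -1], [⟨.framed, (some (0)), [4, 5, 7, 8]⟩, ⟨.framed, (some (0)), [1, 2, 10, 11]⟩], [], 0⟩),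
    (.pass .over 4 7 [] 4 4, ⟨[(8, 1, 4, 11), (4, 1, 8, 11)], [-1, 1], [⟨.framed, (some (0)), [4, 8]⟩, ⟨.framed, (some (0)), [1, 11]⟩], [], 0⟩),
    (.float 0 .under, ⟨[], [], [], [(.framed, (some (0))), (.framed, (some (0)))], 0⟩)]

/-- The `6_1` certificate has one band and ends at the crossingless 2-component unlink: its
terminal condition evaluates to `true` in the kernel. [folklore] -/
theorem cert_6_1_terminalOK : cert_6_1.terminalOK = true := by decide

/-- … and it records exactly one saddle. [folklore] -/
theorem cert_6_1_nBands : cert_6_1.nBands = 1 := by decide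

end Summit.Ventures.SP4Inv
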